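import Summits.BirchSwinnertonDyer.BirchSwinnertonDyer.Theorems.EisensteinDepletionAtTwoStarOptBSFSeventeenModels
import Summits.BirchSwinnertonDyer.BirchSwinnertonDyer.Theorems.EisensteinDepletionAtTwoStarOptBNSFStubTwoPowerWalk
import HarnessLib

/-!
# Line `star` on crux E1M (stmt-BirchSwinnertonDyer-20341): the `2`-power isogeny graph of `17a1` made EXPLICIT, part 2 — the walk

Lead star-p1 GEN 19.  Part 1 (Theorems/…StarOptBSFSeventeenModels) listed the rational `2`-torsion abscissae of the four models `17a1–17a4` and
identified the six explicit `2`-isogeny codomains.  THIS FILE walks: every elliptic curve over `ℚ` reached from a curve `ℚ`-isomorphic to one of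
the four models by an isogeny of `2`-power degree is again `ℚ`-isomorphic to one of the four models (`exists_smul_mem_of_twoPower_isogeny`).
THE WALK (the kernel bookkeeping of `Walk.walk_aux`, line nsf, without type bits and without minimal models): factor `φ = λ ∘ [2^j]` with
`E[2] ⊄ ker λ` (`Walk.exists_eq_comp_twoPow_nsmul`); if `ker λ ≠ 0` it contains a point `S` of order `2`, unique (`Walk.eq_zero_or_eq_of_ker`), hence
`Γ_ℚ`-fixed, hence rational (`Walk.exists_eq_toGeomPoints_of_two_torsion`); one EXPLICIT `2`-isogeny step through `S` (`twoIsogenyStepModel`: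
Silverman's `2`-isogeny on the two-torsion normal form, codomain `K(E, s) = [0, −α/2, 0, α²/16 − 2β, 0]`, `α = b₂ + 12s`, `β = b₄ + s b₂ + 6s²`) lands,
by part 1 and the covariance of `(α, β)` under changes of variables (`codomainModel_smul`), on a curve isomorphic to one of the four models, through
which `λ` factors (AEC III.4.11) with a kernel killed by a smaller power of `2`; at the end `λ` has trivial kernel and is a change of variables
(`Isogeny.exists_variableChange_eq_of_degree_eq_one`).

Fact-free; no `sorry`, no new definition; nothing here reads `r_an`; StarOptB / E1M / BSD are NOT proved (PARTITION D-0054: none — r_an ≥ 2 axis S0).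
-/

set_option linter.dupNamespace false
set_option autoImplicit false

noncomputable section

open scoped Classical
open WeierstrassCurve Literature.NumberTheory.EllipticCurves Literature.NumberTheory.EllipticCurves.Greenberg1999
open Summit.BirchSwinnertonDyer.BirchSwinnertonDyer.Theorems.DepletionAtTwo.Walk

namespace Summit.BirchSwinnertonDyer.BirchSwinnertonDyer.Theorems.DepletionAtTwo.SeventeenClass

/-! ### §1 The codomain model `K(E, s)` and its covariance under changes of variables -/

/-- `α = b₂ + 12x` scales by `u⁻²` under a change of variables `(u, r, s, t)` (`x ↦ u⁻²(x − r)`, `b₂ ↦ u⁻²(b₂ + 12r)`).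
[cite: SilvermanAEC2009, III.1 Table 3.1] -/
theorem alpha_smul (E : WeierstrassCurve ℚ) (C : VariableChange ℚ) (s : ℚ) :
    (C • E).b₂ + 12 * C.toX s = ((C.u⁻¹ : ℚˣ) : ℚ) ^ 2 * (E.b₂ + 12 * s) := by
  rw [variableChange_b₂, VariableChange.toX_def]
  push_cast
  ring

/-- `β = b₄ + x b₂ + 6x²` scales by `u⁻⁴` under a change of variables `(u, r, s, t)`. [cite: SilvermanAEC2009, III.1 Table 3.1] -/
theorem beta_smul (E : WeierstrassCurve ℚ) (C : VariableChange ℚ) (s : ℚ) :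
    (C • E).b₄ + C.toX s * (C • E).b₂ + 6 * C.toX s ^ 2 = ((C.u⁻¹ : ℚˣ) : ℚ) ^ 4 * (E.b₄ + s * E.b₂ + 6 * s ^ 2) := by
  rw [variableChange_b₂, variableChange_b₄, VariableChange.toX_def]
  push_cast
  ring

/-- **Covariance of the codomain model**: `K(C • E, C.toX s) = (u, 0, 0, 0) • K(E, s)`. [cite: SilvermanAEC2009, III.1 Table 3.1 and III.4 Example 4.5] -/
theorem codomainModel_smul (E : WeierstrassCurve ℚ) (C : VariableChange ℚ) (s : ℚ) :
    (⟨C.u, 0, 0, 0⟩ : VariableChange ℚ) •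
        (⟨0, -(E.b₂ + 12 * s) / 2, 0, (E.b₂ + 12 * s) ^ 2 / 16 - 2 * (E.b₄ + s * E.b₂ + 6 * s ^ 2), 0⟩ : WeierstrassCurve ℚ) =
      ⟨0, -((C • E).b₂ + 12 * C.toX s) / 2, 0,
        ((C • E).b₂ + 12 * C.toX s) ^ 2 / 16 - 2 * ((C • E).b₄ + C.toX s * (C • E).b₂ + 6 * C.toX s ^ 2), 0⟩ := by
  rw [beta_smul, alpha_smul, variableChange_def]
  ext <;> simp <;> ring

/-! ### §2 The explicit `2`-isogeny step with its codomain MODEL -/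

/-- **The explicit `2`-isogeny step, model form.**  For an elliptic `E/ℚ` (any model) and a rational point `S = (s, y)` of order `2` there is an
isogeny `π : E → K(E, s)` onto the EXPLICIT model `K(E, s) = [0, −α/2, 0, α²/16 − 2β, 0]` (`α = b₂ + 12s`, `β = b₄ + s b₂ + 6s²`) with `ker π = {O, S}`:
`C = (1, s, −a₁/2, y)` puts `S` at `(0,0)` on the two-torsion normal form `[0, α/4, 0, β/2, 0]` and Silverman's `2`-isogeny maps it to
`[0, −2a, 0, a² − 4b, 0]`. [cite: SilvermanAEC2009, III.4 Example 4.5] -/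
theorem twoIsogenyStepModel (E : WeierstrassCurve ℚ) [E.IsElliptic] {s y : ℚ} (hP : E.toAffine.Nonsingular s y)
    (hy : 2 * y + E.a₁ * s + E.a₃ = 0) :
    ∃ (E₁ : WeierstrassCurve ℚ) (_ : E₁.IsElliptic) (π : Isogeny E E₁),
      (∀ Q : E.geomPoints, π Q = 0 ↔ Q = 0 ∨ Q = toGeomPoints E (Affine.Point.some s y hP)) ∧
      E₁ = ⟨0, -(E.b₂ + 12 * s) / 2, 0, (E.b₂ + 12 * s) ^ 2 / 16 - 2 * (E.b₄ + s * E.b₂ + 6 * s ^ 2), 0⟩ := by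
  set C : VariableChange ℚ := ⟨1, s, -E.a₁ / 2, y⟩ with hC
  haveI hNF : (C • E).IsTwoTorsionNF :=
    isTwoTorsionNF_smul_of_two_nsmul_eq_zero two_ne_zero hP (by rw [Affine.negY]; linear_combination hy)
  let π : Isogeny E (C • E).twoIsogenyCodomain := (C • E).twoIsogeny.comp (VariableChange.toIsogeny E C)
  have hT : VariableChange.toIsogeny E C (toGeomPoints E (Affine.Point.some s y hP)) = (C • E).geomTwoTorsionPoint :=
    toIsogeny_toGeomPoints_eq_geomTwoTorsionPoint E hP hy
  refine ⟨(C • E).twoIsogenyCodomain, inferInstance, π, fun Q ↦ ?_, ?_⟩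
  · -- kernel
    show (C • E).twoIsogeny (VariableChange.toIsogeny E C Q) = 0 ↔ _
    rw [twoIsogeny_apply, ← AddMonoidHom.mem_ker, mem_ker_twoIsogenyGeomHom_iff, ← hT, ← map_zero (VariableChange.toIsogeny E C),
      (VariableChange.toIsogeny_injective E C).eq_iff, (VariableChange.toIsogeny_injective E C).eq_iff]
  · -- the model
    have h2 := four_mul_a₂_of_isTwoTorsionNF_smul E C
    have h4 := two_mul_a₄_of_isTwoTorsionNF_smul E C
    have hu : ((C.u⁻¹ : ℚˣ) : ℚ) = 1 := by simp [hC]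
    have hr : C.r = s := rfl
    rw [hu, hr] at h2 h4
    have ha₂ : (C • E).a₂ = (E.b₂ + 12 * s) / 4 := by linear_combination h2 / 4
    have ha₄ : (C • E).a₄ = (E.b₄ + s * E.b₂ + 6 * s ^ 2) / 2 := by linear_combination h4 / 2
    rw [WeierstrassCurve.twoIsogenyCodomain, ha₂, ha₄]
    ext <;> simp <;> ring

/-! ### §3 The walk -/

/-- One step of the invariant: if `C • E` is one of the four models and `S = (s, y)` is a rational point of order `2` of `E`, then the explicit codomain
`K(E, s)` is `ℚ`-isomorphic to one of the four models (part 1's `exists_smul_codomain_mem_of_mem` on `(C • E, C.toX s)`, transported by `codomainModel_smul`).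
[cite: SilvermanAEC2009, III.4 Example 4.5] [cite: CremonaAlgorithms1997, Table 1 (N = 17)] -/
theorem exists_smul_codomainModel_mem (E : WeierstrassCurve ℚ) (C : VariableChange ℚ) (M : WeierstrassCurve ℚ)
    (hM : M = ⟨1, -1, 1, -1, -14⟩ ∨ M = ⟨1, -1, 1, -6, -4⟩ ∨ M = ⟨1, -1, 1, -91, -310⟩ ∨ M = ⟨1, -1, 1, -1, 0⟩) (hCE : C • E = M)
    {s : ℚ} (hs : HasRationalTwoTorsionX E s) :
    ∃ (C₁ : VariableChange ℚ) (M₁ : WeierstrassCurve ℚ),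
      (M₁ = ⟨1, -1, 1, -1, -14⟩ ∨ M₁ = ⟨1, -1, 1, -6, -4⟩ ∨ M₁ = ⟨1, -1, 1, -91, -310⟩ ∨ M₁ = ⟨1, -1, 1, -1, 0⟩) ∧
      C₁ • (⟨0, -(E.b₂ + 12 * s) / 2, 0, (E.b₂ + 12 * s) ^ 2 / 16 - 2 * (E.b₄ + s * E.b₂ + 6 * s ^ 2), 0⟩ : WeierstrassCurve ℚ) = M₁ := by
  have hs' : HasRationalTwoTorsionX M (C.toX s) := by
    rw [← hCE]; exact PrimeConductorTwoTorsion.hasRationalTwoTorsionX_smul E C hs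
  obtain ⟨D, hD⟩ := exists_smul_codomain_mem_of_mem M hM hs'
  subst hCE
  rw [← codomainModel_smul E C s, smul_smul] at hD
  rcases hD with h | h | h | h
  · exact ⟨_, _, Or.inl rfl, h⟩
  · exact ⟨_, _, Or.inr (Or.inl rfl), h⟩
  · exact ⟨_, _, Or.inr (Or.inr (Or.inl rfl)), h⟩
  · exact ⟨_, _, Or.inr (Or.inr (Or.inr rfl)), h⟩

/-- **The inductive walk in the `2`-power isogeny class of `17a`.**  For an elliptic `E/ℚ` isomorphic to one of the four models, an isogeny `λ : E → V`
whose kernel is killed by `2^k`, and a geometric point `P₀` of order dividing `2` with `λ P₀ ≠ O`: `V` is isomorphic to one of the four models.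
Induction on `k` (kernel bookkeeping as in `Walk.walk_aux`): at `k = 0`, `λ` is a change of variables; otherwise either `2^(k−1)` kills `ker λ`, or
`S = 2^(k−1) P ∈ ker λ` is a point of order `2`, the only one in `ker λ` (`P₀ ∉ ker λ`), hence rational; one explicit step through `S` and `λ = λ₁ ∘ π`.
[cite: SilvermanAEC2009, Cor. III.4.11 and III.4 Example 4.5] [cite: CremonaAlgorithms1997, Table 1 (N = 17)] -/
theorem walk17_aux (k : ℕ) :
    ∀ (E : WeierstrassCurve ℚ) [E.IsElliptic] (V : WeierstrassCurve ℚ) [V.IsElliptic] (lam : Isogeny E V),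
      (∃ (C : VariableChange ℚ) (M : WeierstrassCurve ℚ),
        (M = ⟨1, -1, 1, -1, -14⟩ ∨ M = ⟨1, -1, 1, -6, -4⟩ ∨ M = ⟨1, -1, 1, -91, -310⟩ ∨ M = ⟨1, -1, 1, -1, 0⟩) ∧ C • E = M) →
      (∀ P : E.geomPoints, lam P = 0 → (2 ^ k : ℕ) • P = 0) →
      (∃ P₀ : E.geomPoints, P₀ + P₀ = 0 ∧ lam P₀ ≠ 0) →
      ∃ (C : VariableChange ℚ) (M : WeierstrassCurve ℚ),
        (M = ⟨1, -1, 1, -1, -14⟩ ∨ M = ⟨1, -1, 1, -6, -4⟩ ∨ M = ⟨1, -1, 1, -91, -310⟩ ∨ M = ⟨1, -1, 1, -1, 0⟩) ∧ C • V = M := by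
  induction k with
  | zero =>
    intro E _ V _ lam hE hk _
    obtain ⟨C, M, hM, hCE⟩ := hE
    have hdeg : lam.degree = 1 := by
      unfold Isogeny.degree
      have hbot : lam.toAddMonoidHom.ker = ⊥ := (AddMonoidHom.ker_eq_bot_iff _).mpr fun P Q h ↦ by
        have h0 : lam (P - Q) = 0 := by rw [map_sub]; exact sub_eq_zero.mpr h
        have := hk _ h0
        exact sub_eq_zero.mp (by simpa using this)
      rw [hbot, AddSubgroup.card_bot]
    obtain ⟨C₀, hC₀⟩ := lam.exists_variableChange_eq_of_degree_eq_one hdeg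
    refine ⟨C * C₀⁻¹, M, hM, ?_⟩
    rw [← hC₀, ← smul_smul, inv_smul_smul, hCE]
  | succ k ih =>
    intro E _ V _ lam hE hk hP₀
    obtain ⟨C, M, hM, hCE⟩ := hE
    obtain ⟨P₀, hP₀2, hlamP₀⟩ := hP₀
    by_cases hsmall : ∀ P : E.geomPoints, lam P = 0 → (2 ^ k : ℕ) • P = 0
    · exact ih E V lam ⟨C, M, hM, hCE⟩ hsmall ⟨P₀, hP₀2, hlamP₀⟩
    push Not at hsmall
    obtain ⟨P, hPker, hPk⟩ := hsmall
    -- the point `S = 2^k P` of order `2` in `ker λ`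
    set S : E.geomPoints := (2 ^ k : ℕ) • P with hSdef
    have hS0 : S ≠ 0 := hPk
    have hS2 : S + S = 0 := by
      rw [hSdef, ← two_nsmul, ← mul_nsmul, ← pow_succ]
      exact hk P hPker
    have hlamS : lam S = 0 := by rw [hSdef, map_nsmul, hPker, nsmul_zero]
    have hP₀0 : P₀ ≠ 0 := fun h ↦ hlamP₀ (by rw [h, map_zero])
    have hSfix : ∀ σ : Field.absoluteGaloisGroup ℚ, σ • S = S := by
      intro σ
      have hσ2 : σ • S + σ • S = 0 := by rw [← smul_add, hS2, smul_zero]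
      have hσlam : lam (σ • S) = 0 := by rw [lam.map_smul, hlamS, smul_zero]
      rcases eq_zero_or_eq_of_ker lam hS2 hP₀2 hσ2 hS0 hP₀0 hlamS hlamP₀ hσlam with h | h
      · exact absurd (MulAction.injective σ (h.trans (smul_zero σ).symm)) hS0
      · exact h
    -- `S` is rational: `S = (s, y_s)`
    obtain ⟨s, ys, hPs, hSeq, hys⟩ := exists_eq_toGeomPoints_of_two_torsion (E := E) hS0 hS2 hSfix
    have hs : HasRationalTwoTorsionX E s := hasRationalTwoTorsionX_of_nonsingular hPs hys
    -- the explicit step through `S`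
    obtain ⟨E₁, hE₁, π, hkerπ, hE₁eq⟩ := twoIsogenyStepModel E hPs hys
    haveI := hE₁
    -- `E₁` is again one of the four models up to isomorphism
    have hE₁mem : ∃ (C₁ : VariableChange ℚ) (M₁ : WeierstrassCurve ℚ),
        (M₁ = ⟨1, -1, 1, -1, -14⟩ ∨ M₁ = ⟨1, -1, 1, -6, -4⟩ ∨ M₁ = ⟨1, -1, 1, -91, -310⟩ ∨ M₁ = ⟨1, -1, 1, -1, 0⟩) ∧ C₁ • E₁ = M₁ := by
      obtain ⟨C₁, M₁, hM₁, h⟩ := exists_smul_codomainModel_mem E C M hM hCE hs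
      exact ⟨C₁, M₁, hM₁, by rw [hE₁eq]; exact h⟩
    -- factor `λ = λ₁ ∘ π`
    have hsep : π.deg ≤ Nat.card π.toAddMonoidHom.ker := le_of_eq (Isogeny.degree_eq_deg π).symm
    have hkerle : ∀ Q : E.geomPoints, π Q = 0 → lam Q = 0 := by
      intro Q hQ
      rcases (hkerπ Q).mp hQ with h | h
      · rw [h, map_zero]
      · rw [h, ← hSeq, hlamS]
    obtain ⟨lam₁, hlam₁⟩ := π.exists_eq_comp_of_ker_le lam hsep hkerle
    -- the new witness `π P₀`
    have hP₁ : lam₁ (π P₀) ≠ 0 := by rw [← hlam₁]; exact hlamP₀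
    have hP₁2 : π P₀ + π P₀ = 0 := by rw [← map_add, hP₀2, map_zero]
    -- `2^k` kills `ker λ₁`
    have hk₁ : ∀ Q : E₁.geomPoints, lam₁ Q = 0 → (2 ^ k : ℕ) • Q = 0 := by
      intro Q hQ
      obtain ⟨R, rfl⟩ := π.surjective Q
      have hR : lam R = 0 := by rw [hlam₁]; exact hQ
      have hR2 : (2 ^ k : ℕ) • R + (2 ^ k : ℕ) • R = 0 := by
        rw [← two_nsmul, ← mul_nsmul, ← pow_succ]
        exact hk R hR
      have hRlam : lam ((2 ^ k : ℕ) • R) = 0 := by rw [map_nsmul, hR, nsmul_zero]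
      rw [← map_nsmul]
      rcases eq_zero_or_eq_of_ker lam hS2 hP₀2 hR2 hS0 hP₀0 hlamS hlamP₀ hRlam with h | h
      · rw [h, map_zero]
      · rw [h]
        exact (hkerπ S).mpr (Or.inr hSeq)
    exact ih E₁ V lam₁ hE₁mem hk₁ ⟨π P₀, hP₁2, hP₁⟩

/-- **The `2`-power isogeny class of `17a1` consists of curves isomorphic to `17a1`, `17a2`, `17a3`, `17a4`.**  For elliptic `W₀, V` over `ℚ`, an isogeny
`φ : W₀ → V` of degree `2^k`, and a change of variables with `C₀ • W₀` one of the four models: `C • V` is one of the four models for some `C`.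
(Factor `φ = λ ∘ [2^j]` with `W₀[2] ⊄ ker λ`, then `walk17_aux`.) [cite: SilvermanAEC2009, Cor. III.4.11 and III.4 Example 4.5] [cite: CremonaAlgorithms1997, Table 1 (N = 17)] -/
theorem exists_smul_mem_of_twoPower_isogeny (W₀ V : WeierstrassCurve ℚ) [W₀.IsElliptic] [V.IsElliptic] (φ : Isogeny W₀ V)
    (hk : ∃ k : ℕ, φ.degree = 2 ^ k) (C₀ : VariableChange ℚ)
    (hC₀ : C₀ • W₀ = ⟨1, -1, 1, -1, -14⟩ ∨ C₀ • W₀ = ⟨1, -1, 1, -6, -4⟩ ∨ C₀ • W₀ = ⟨1, -1, 1, -91, -310⟩ ∨ C₀ • W₀ = ⟨1, -1, 1, -1, 0⟩) :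
    ∃ (C : VariableChange ℚ) (M : WeierstrassCurve ℚ),
      (M = ⟨1, -1, 1, -1, -14⟩ ∨ M = ⟨1, -1, 1, -6, -4⟩ ∨ M = ⟨1, -1, 1, -91, -310⟩ ∨ M = ⟨1, -1, 1, -1, 0⟩) ∧ C • V = M := by
  obtain ⟨k, hk⟩ := hk
  -- `φ = λ ∘ [2^j]`, `W₀[2] ⊄ ker λ`
  obtain ⟨j, lam, hlam, P₀, hP₀2, hlamP₀⟩ := exists_eq_comp_twoPow_nsmul φ
  have hkφ := twoPow_nsmul_eq_zero_of_degree φ hk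
  have hklam : ∀ Q : W₀.geomPoints, lam Q = 0 → (2 ^ k : ℕ) • Q = 0 := by
    intro Q hQ
    obtain ⟨R, hR⟩ := (Isogeny.nsmul W₀ (2 ^ j) (pow_ne_zero j two_ne_zero)).surjective Q
    rw [Isogeny.nsmul_apply] at hR
    subst hR
    have hφR : φ R = 0 := by rw [hlam]; exact hQ
    rw [← mul_nsmul', mul_comm, mul_nsmul', hkφ R hφR, nsmul_zero]
  have hmem : ∃ (C : VariableChange ℚ) (M : WeierstrassCurve ℚ),
      (M = ⟨1, -1, 1, -1, -14⟩ ∨ M = ⟨1, -1, 1, -6, -4⟩ ∨ M = ⟨1, -1, 1, -91, -310⟩ ∨ M = ⟨1, -1, 1, -1, 0⟩) ∧ C • W₀ = M := by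
    rcases hC₀ with h | h | h | h
    · exact ⟨C₀, _, Or.inl rfl, h⟩
    · exact ⟨C₀, _, Or.inr (Or.inl rfl), h⟩
    · exact ⟨C₀, _, Or.inr (Or.inr (Or.inl rfl)), h⟩
    · exact ⟨C₀, _, Or.inr (Or.inr (Or.inr rfl)), h⟩
  exact walk17_aux k W₀ V lam hmem hklam ⟨P₀, hP₀2, hlamP₀⟩

end Summit.BirchSwinnertonDyer.BirchSwinnertonDyer.Theorems.DepletionAtTwo.SeventeenClass

end
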